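import Summits.CriticalPhenomena.PercolationContinuityZ3.Theorems.PercNearOneGluingNoHeavyLowerTailSahiCombTriWShell

/-!
# `TRI_W(a)`: the TOP INDEX LEVEL of the dipole token system is self-sufficient (a four-up-set inequality from the three-up-set inequality)

Support file of the one-cut programme (crux `NoHeavyLowerTail`, stmt-CriticalPhenomena-4575; cell `prim-masterthm`, seat P5 gen 22;
memo `FROM-prim-masterthm-p5-g22-SEPARABLE-CERTIFICATES.md` §2).  Target of the lane: `FiveUpSet.TriWIneq` (`…SahiCombTriWGeneral`, OPEN for `a ≥ 2`).

In the DIPOLE (Hall) form of `triW P F G` (`…SahiCombTriWDipoleCert`, `…SahiCombTriWComboHall`) the index level `x` of the cube `Finset β` carries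
the supply tokens `A(x) = B(x) = P ∩ F x` (two core copies) and `E(x) = refl P ∩ F xᶜ`, and the demand tokens `D₁(x) = refl P ∩ F x`,
`D₂(x) = P ∩ refl (F xᶜ)`, `D₃(x) = refl P ∩ refl (F xᶜ)`; `TriWIneq` says the demands can be matched upward (in the product order on
`Finset β × Finset γ`) into the supplies.  This file proves that the TOP level `x = univ` (where `F univ ⊇ F ∅ = F univᶜ`) needs no help from
below and even has one core copy on `P ∩ (F univ \ F ∅)` to spare: for up-sets `K, P, A₀ ⊆ A₁` (read `A₀ = F ∅`, `A₁ = F univ`, `K` = a test up-set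
of the fibre cube),

  **`#(K ∩ refl P ∩ A₁) + #(K ∩ P ∩ refl A₀) + #(K ∩ refl P ∩ refl A₀) ≤ #(K ∩ P ∩ A₁) + #(K ∩ P ∩ A₀) + #(K ∩ refl P ∩ A₀)`**

(`FiveUpSet.topLevel_ineq`).  Equivalently: the "anti-Kleitman" deficit of `A₀` inside the mixed family `K ∩ refl P`,
`#(K ∩ refl P ∩ refl A₀) − #(K ∩ refl P ∩ A₀)`, is at most the sum of the two genuine Kleitman gaps `Kl_{K∩A₁}(P) + Kl_{K∩P}(A₀)`.
PROOF.  After the antipodal rewriting `#(K ∩ refl P ∩ X) = #(P ∩ refl K ∩ refl X)` (`card_refl_inter_inter`) and splitting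
`refl A₁ = refl (A₁ \ A₀) ⊔ refl A₀`, the inequality is EXACTLY the three-up-set inequality `threeUpSetIneq_holds` for `(P; A₀ ⊆ A₁; B = K)`
plus Kleitman's lemma `#(P ∩ A₀ ∩ refl K) ≤ #(P ∩ A₀ ∩ K)` (found by an exact type-level LP, `code22/py/c4cone.py`; census of the inequality itself:
exhaustive `n ≤ 4`, 2.1e8 quadruples, `code22/c/coltop2.c`).  Corollaries: the plain form with both core copies (`topLevel_ineq'`) and the
dipole-system reading for a monotone family (`topLevel_selfSufficient`).
HONEST LABEL: a corollary of the (proved) three-up-set inequality; it settles only the top index level of the Hall system behind `TriWIneq`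
(the level-local part of COMBO1 at `x = univ`), not `TriWIneq`. [this work]
-/

namespace Summit.CriticalPhenomena.PercolationContinuityZ3.Theorems

namespace FiveUpSet

open Finset

variable {γ : Type} [DecidableEq γ] [Fintype γ]

/-- Splitting a reflected nested pair: for `A₀ ⊆ A₁`, `#(S ∩ refl A₁) = #(S ∩ refl (A₁ \ A₀)) + #(S ∩ refl A₀)`. [this work] -/
theorem card_inter_refl_split (S A₀ A₁ : Finset (Finset γ)) (hA : A₀ ⊆ A₁) :
    (S ∩ refl A₁).card = (S ∩ refl (A₁ \ A₀)).card + (S ∩ refl A₀).card := by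
  have hsub : S ∩ refl A₀ ⊆ S ∩ refl A₁ := by
    intro s hs
    rw [mem_inter, mem_refl] at hs ⊢
    exact ⟨hs.1, hA hs.2⟩
  have heq : S ∩ refl (A₁ \ A₀) = (S ∩ refl A₁) \ (S ∩ refl A₀) := by
    ext s
    simp only [mem_inter, mem_sdiff, mem_refl, not_and]
    constructor
    · rintro ⟨hs, h1, h0⟩
      exact ⟨⟨hs, h1⟩, fun _ => h0⟩
    · rintro ⟨⟨hs, h1⟩, h⟩
      exact ⟨hs, h1, h hs⟩
  rw [heq]
  have := card_sdiff_add_card_eq_card hsub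
  omega

/-- **The top-level inequality.**  For up-sets `K, P, A₀ ⊆ A₁` of a finite cube,
`#(K ∩ refl P ∩ A₁) + #(K ∩ P ∩ refl A₀) + #(K ∩ refl P ∩ refl A₀) ≤ #(K ∩ P ∩ A₁) + #(K ∩ P ∩ A₀) + #(K ∩ refl P ∩ A₀)`:
in the dipole token system of `TRI_W(a)` the top index level (`A₀ = F ∅ ⊆ A₁ = F univ`) matches all its demands (`D₁ = refl P ∩ A₁`,
`D₂ = P ∩ refl A₀`, `D₃ = refl P ∩ refl A₀`) inside itself using one core copy `P ∩ A₁`, the reduced core copy `P ∩ A₀` and `E = refl P ∩ A₀`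
(Hall form over every test up-set `K`).  Proof: three-up-set inequality for `(P; A₀ ⊆ A₁; K)` + Kleitman for `(P ∩ A₀; K)` after antipodal
rewriting. [this work] -/
theorem topLevel_ineq (K P A₀ A₁ : Finset (Finset γ)) (hK : IsUpperSet (K : Set (Finset γ))) (hP : IsUpperSet (P : Set (Finset γ)))
    (hA₀ : IsUpperSet (A₀ : Set (Finset γ))) (hA₁ : IsUpperSet (A₁ : Set (Finset γ))) (hA : A₀ ⊆ A₁) :
    (K ∩ refl P ∩ A₁).card + (K ∩ P ∩ refl A₀).card + (K ∩ refl P ∩ refl A₀).card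
      ≤ (K ∩ P ∩ A₁).card + (K ∩ P ∩ A₀).card + (K ∩ refl P ∩ A₀).card := by
  -- the three-up-set inequality for (P; A₀ ⊆ A₁; B = K) and Kleitman's lemma for (P ∩ A₀; K)
  have h3 := threeUpSetIneq_holds γ P A₀ A₁ K hP hA₀ hA₁ hK hA
  have hPA₀ : IsUpperSet ((P ∩ A₀ : Finset (Finset γ)) : Set (Finset γ)) := by
    rw [coe_inter]; exact hP.inter hA₀
  have hk : (P ∩ A₀ ∩ refl K).card ≤ (P ∩ A₀ ∩ K).card := card_inter_refl_le hPA₀ hK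
  -- antipodal rewriting of the three `refl P` terms
  have e1 : (K ∩ refl P ∩ A₁).card = (P ∩ refl K ∩ refl A₁).card := by
    rw [show K ∩ refl P ∩ A₁ = refl P ∩ K ∩ A₁ by rw [inter_comm K], card_refl_inter_inter]
  have e2 : (K ∩ refl P ∩ refl A₀).card = (P ∩ refl K ∩ A₀).card := by
    rw [show K ∩ refl P ∩ refl A₀ = refl P ∩ K ∩ refl A₀ by rw [inter_comm K], card_refl_inter_inter, refl_refl]
  have e3 : (K ∩ refl P ∩ A₀).card = (P ∩ refl K ∩ refl A₀).card := by
    rw [show K ∩ refl P ∩ A₀ = refl P ∩ K ∩ A₀ by rw [inter_comm K], card_refl_inter_inter]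
  have e4 := card_inter_refl_split (P ∩ refl K) A₀ A₁ hA
  -- aligning the remaining intersections with the orderings used by `threeUpSetIneq_holds` and `hk`
  have e5 : P ∩ refl K ∩ refl (A₁ \ A₀) = P ∩ refl (A₁ \ A₀) ∩ refl K := inter_right_comm _ _ _
  have e6 : K ∩ P ∩ refl A₀ = P ∩ refl A₀ ∩ K := by
    rw [inter_comm K P, inter_right_comm]
  have e7 : K ∩ P ∩ A₁ = P ∩ A₁ ∩ K := by
    rw [inter_comm K P, inter_right_comm]
  have e8 : K ∩ P ∩ A₀ = P ∩ A₀ ∩ K := by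
    rw [inter_comm K P, inter_right_comm]
  have e9 : P ∩ refl K ∩ A₀ = P ∩ A₀ ∩ refl K := inter_right_comm _ _ _
  rw [e1, e2, e3, e4, e5, e6, e7, e8, e9]
  omega

/-- The plain form with both core copies: `#(K ∩ refl P ∩ A₁) + #(K ∩ P ∩ refl A₀) + #(K ∩ refl P ∩ refl A₀) ≤ 2·#(K ∩ P ∩ A₁) + #(K ∩ refl P ∩ A₀)`
(census `code22/c/coltop.c`: exhaustive `n ≤ 4`). [this work] -/
theorem topLevel_ineq' (K P A₀ A₁ : Finset (Finset γ)) (hK : IsUpperSet (K : Set (Finset γ))) (hP : IsUpperSet (P : Set (Finset γ)))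
    (hA₀ : IsUpperSet (A₀ : Set (Finset γ))) (hA₁ : IsUpperSet (A₁ : Set (Finset γ))) (hA : A₀ ⊆ A₁) :
    (K ∩ refl P ∩ A₁).card + (K ∩ P ∩ refl A₀).card + (K ∩ refl P ∩ refl A₀).card
      ≤ 2 * (K ∩ P ∩ A₁).card + (K ∩ refl P ∩ A₀).card := by
  have h := topLevel_ineq K P A₀ A₁ hK hP hA₀ hA₁ hA
  have hmono : (K ∩ P ∩ A₀).card ≤ (K ∩ P ∩ A₁).card :=
    card_le_card (inter_subset_inter_left hA)
  omega

variable {β : Type} [DecidableEq β] [Fintype β]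

/-- **Dipole reading: the top index level is self-sufficient.**  For an up-set `P`, a monotone family `F` of up-sets indexed by `Finset β`
and every test up-set `K` of the fibre cube, the demand tokens of the top level `x = univ` of the dipole system
(`D₁ = refl P ∩ F univ`, `D₂ = P ∩ refl (F univᶜ) = P ∩ refl (F ∅)`, `D₃ = refl P ∩ refl (F ∅)`) are dominated inside `K` by ONE core copy
`P ∩ F univ`, the reduced copy `P ∩ F ∅` and `E(univ) = refl P ∩ F ∅` — so in any COMBO1-type matching the top level exports nothing and keeps
a full core copy on `P ∩ (F univ \ F ∅)` free for imports. [this work] -/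
theorem topLevel_selfSufficient (K P : Finset (Finset γ)) (F : Finset β → Finset (Finset γ))
    (hK : IsUpperSet (K : Set (Finset γ))) (hP : IsUpperSet (P : Set (Finset γ)))
    (hF : ∀ x, IsUpperSet (F x : Set (Finset γ))) (hFm : Monotone F) :
    (K ∩ refl P ∩ F univ).card + (K ∩ P ∩ refl (F univᶜ)).card + (K ∩ refl P ∩ refl (F univᶜ)).card
      ≤ (K ∩ P ∩ F univ).card + (K ∩ P ∩ F univᶜ).card + (K ∩ refl P ∩ F univᶜ).card := by
  rw [compl_univ]
  exact topLevel_ineq K P (F ∅) (F univ) hK hP (hF ∅) (hF univ) (hFm (empty_subset _))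

end FiveUpSet

end Summit.CriticalPhenomena.PercolationContinuityZ3.Theorems
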